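import Summits.ResolutionOfSingularities.ResolutionOfSingularities.Theorems.WildPurityWildSymbolBasinCalibration
import Mathlib.RingTheory.Jacobson.Ring
import HarnessLib

/-!
# `WildSymbol` (stmt-ResolutionOfSingularities-17133), line `birth` — calibration at CLOSED points:
# a dominating discrete basin at a closed point is impossible

Support file for crux #2 of route `ResolutionOfSingularities/WildPurity`
(`Summit.ResolutionOfSingularities.ResolutionOfSingularities.Theses.WildPurity.WildSymbol`), line `birth`
(definitions `Theorems/WildPurityWildSymbolBirthDefs.lean`; basin `…BasinCalibration.lean`; absorption at
discrete places with perfect residue field `…ArcPlaces.lean`). Lead's calibration of the open stub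
`stub_selfSimilarGerm` (registered sub-goal `not_selfSimilarGerm_closedPoint_discrete_dominating_basin`).

* `exists_pow_p_sub_mem_nonunits_of_fg` — ZARISKI + PERFECTNESS: if `R` is a finitely generated
  `k`-subalgebra of `K` inside the valuation ring `O ⊇ k` (`k` perfect of characteristic `p`) and the centre
  of `O` on `R` is a MAXIMAL ideal (stated elementarily: every element of `R` outside the centre is
  invertible in `R` modulo the centre), then every `r ∈ R` is a `p`-th power modulo the centre:
  `r − eᵖ ∈ 𝔪_O` for some `e ∈ R`. (The residue field `R/P` is a field finitely generated as a `k`-algebra,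
  hence finite over `k` — `finite_of_finite_type_of_isJacobsonRing` — hence perfect.)
* `locAt_pow_p_residue` — the same for the local ring `locAt R O` of the point (closure induction).
* `basin_pow_p_residue` — if moreover `T` is the basin of a chart step `σ⁻¹ S ⊆ S` over `S = locAt R O`
  (`x ∈ T ↔ σ⁻ⁿ x ∈ S` for some `n`) and `T` DOMINATES `S` (`𝔪_S ⊆ 𝔪_T`), then every element of `T` is a
  `p`-th power modulo `𝔪_T`: the residue field of the basin is perfect. (Domination is automatic: `σ⁻¹`
  acts on `S` by a local homomorphism by the dimension formula — paper remark in the crux notes; it is kept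
  as an explicit hypothesis here.)
* `not_selfSimilarGerm_closedPoint_discrete_dominating_basin` — CALIBRATION (negative lemma, line
  language): the germ stub `Sig.stub_selfSimilarGerm` at a CLOSED point (centre maximal) whose basin is a
  DVR dominating the local ring of the point is FALSE (`mem_Unr_of_discrete_perfect_basin`). With
  `…PerfectHullDense.lean` this leaves for a germ at a closed point only NON-discrete basins of
  dependent-defect type or of rational rank `≥ 2` / imperfect residue field.

No definition is declared; nothing concludes the crux positively.
-/

noncomputable section

-- single-problem summit: the doubled namespace component `ResolutionOfSingularities` is forced
set_option linter.dupNamespace false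

namespace Summit.ResolutionOfSingularities.ResolutionOfSingularities.Theorems.WildSymbol.Birth

variable {k K : Type} [Field k] [Field K] [Algebra k K]

/-! ## Residues at a closed point are `p`-th powers -/

/-- **Zariski + perfectness.** For a finitely generated `k`-subalgebra `R ⊆ O` (`k ⊆ O` perfect of
characteristic `p`) whose centre `{r ∈ R | r ∈ 𝔪_O}` is maximal (every `x ∈ R ∖ 𝔪_O` has a `y ∈ R` with
`x y − 1 ∈ 𝔪_O`), every `r ∈ R` is congruent to a `p`-th power of an element of `R` modulo `𝔪_O`.
[folklore] -/
theorem exists_pow_p_sub_mem_nonunits_of_fg {p : ℕ} (hp : p.Prime) [CharP k p] [PerfectField k]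
    (R : Subalgebra k K) (hR : R.FG) (O : ValuationSubring K) (hRO : R.toSubring ≤ O.toSubring)
    (hmax : ∀ x : K, x ∈ R → x ∉ O.nonunits → ∃ y : K, y ∈ R ∧ x * y - 1 ∈ O.nonunits) :
    ∀ r : K, r ∈ R → ∃ e : K, e ∈ R ∧ r - e ^ p ∈ O.nonunits := by
  haveI := Fact.mk hp
  have hRO' : ∀ a : R, (a : K) ∈ O := fun a => hRO a.2
  -- the centre of `O` on `R`, as an ideal of `R`
  let P : Ideal R :=
    { carrier := {x | (x : K) ∈ O.nonunits}
      add_mem' := fun {x y} hx hy => by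
        show ((x + y : R) : K) ∈ O.nonunits
        rw [Subalgebra.coe_add]
        exact O.nonunits.add_mem hx hy
      zero_mem' := by
        show ((0 : R) : K) ∈ O.nonunits
        rw [Subalgebra.coe_zero]
        exact O.nonunits.zero_mem
      smul_mem' := fun c x hx => by
        show ((c * x : R) : K) ∈ O.nonunits
        rw [Subalgebra.coe_mul, mul_comm]
        exact mul_mem_nonunits O hx (hRO' c) }
  have hP : ∀ x : R, x ∈ P ↔ (x : K) ∈ O.nonunits := fun x => Iff.rfl
  -- `R ⧸ P` is a field
  have h1P : (1 : R) ∉ P := by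
    rw [hP, Subalgebra.coe_one, ValuationSubring.mem_nonunits_iff, map_one]
    exact lt_irrefl 1
  have hfield : IsField (R ⧸ P) := by
    refine ⟨⟨0, 1, fun h => h1P ((Ideal.Quotient.eq_zero_iff_mem).mp h.symm)⟩, mul_comm, ?_⟩
    intro a ha
    obtain ⟨x, rfl⟩ := Ideal.Quotient.mk_surjective a
    have hx : x ∉ P := fun h => ha (Ideal.Quotient.eq_zero_iff_mem.mpr h)
    obtain ⟨y, hyR, hxy⟩ := hmax x x.2 hx
    refine ⟨Ideal.Quotient.mk P ⟨y, hyR⟩, ?_⟩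
    rw [← map_mul, ← (Ideal.Quotient.mk P).map_one, Ideal.Quotient.eq, hP, Subalgebra.coe_sub,
      Subalgebra.coe_mul, Subalgebra.coe_one]
    exact hxy
  haveI hPmax : P.IsMaximal := Ideal.Quotient.maximal_of_isField P hfield
  letI : Field (R ⧸ P) := Ideal.Quotient.field P
  -- Zariski: `R ⧸ P` is finite, hence algebraic, over `k`; so it is a perfect field of characteristic `p`
  haveI : Algebra.FiniteType k R := R.fg_iff_finiteType.mp hR
  haveI : Algebra.FiniteType k (R ⧸ P) := inferInstance
  haveI : Module.Finite k (R ⧸ P) := finite_of_finite_type_of_isJacobsonRing k (R ⧸ P)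
  haveI : PerfectField (R ⧸ P) := Algebra.IsAlgebraic.perfectField k
  haveI : CharP (R ⧸ P) p := charP_of_injective_algebraMap (algebraMap k (R ⧸ P)).injective p
  intro r hr
  obtain ⟨e, he⟩ := Ideal.Quotient.mk_surjective ((frobeniusEquiv (R ⧸ P) p).symm (Ideal.Quotient.mk P ⟨r, hr⟩))
  refine ⟨(e : K), e.2, ?_⟩
  have h : Ideal.Quotient.mk P (⟨r, hr⟩ - e ^ p) = 0 := by
    rw [map_sub, map_pow, he, frobeniusEquiv_symm_pow_p, sub_self]
  have h' := (hP _).mp (Ideal.Quotient.eq_zero_iff_mem.mp h)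
  rw [Subalgebra.coe_sub, Subalgebra.coe_pow] at h'
  exact h'

/-- A non-unit of `O` divided by a unit of `O` is a non-unit. [folklore] -/
theorem mul_inv_mem_nonunits (O : ValuationSubring K) {x u : K} (hx : x ∈ O.nonunits) (huO : u ∈ O)
    (hu : u ∉ O.nonunits) : x * u⁻¹ ∈ O.nonunits := by
  have _ := huO
  exact mul_mem_nonunits O hx (inv_mem_of_not_mem_nonunits O hu)

/-- **The local ring of a closed point has `p`-th power residues**: under the hypotheses of
`exists_pow_p_sub_mem_nonunits_of_fg`, every `s ∈ locAt R O` is congruent modulo `𝔪_O` to `eᵖ` for some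
`e ∈ locAt R O`. [folklore] -/
theorem locAt_pow_p_residue {p : ℕ} (hp : p.Prime) [CharP k p] [PerfectField k]
    (R : Subalgebra k K) (hR : R.FG) (O : ValuationSubring K) (hk : ∀ c : k, algebraMap k K c ∈ O)
    (hRO : R.toSubring ≤ O.toSubring)
    (hmax : ∀ x : K, x ∈ R → x ∉ O.nonunits → ∃ y : K, y ∈ R ∧ x * y - 1 ∈ O.nonunits) :
    ∀ s : K, s ∈ locAt (R : Set K) O → ∃ e : K, e ∈ locAt (R : Set K) O ∧ s - e ^ p ∈ O.nonunits := by
  haveI := Fact.mk hp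
  haveI : CharP K p := charP_of_injective_algebraMap (algebraMap k K).injective p
  have _ := hk
  have hres := exists_pow_p_sub_mem_nonunits_of_fg hp R hR O hRO hmax
  have hle : locAt (R : Set K) O ≤ O.toSubring := by
    refine Subring.closure_le.mpr ?_
    rintro x ⟨r, s', hr, hs', hs'u, hxs⟩
    have hs'0 : s' ≠ 0 := ne_zero_of_not_mem_nonunits O hs'u
    have hx : x = r * s'⁻¹ := by rw [← hxs, mul_assoc, mul_inv_cancel₀ hs'0, mul_one]
    rw [hx]
    exact O.mul_mem _ _ (hRO hr) (inv_mem_of_not_mem_nonunits O hs'u)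
  intro s hs
  induction hs using Subring.closure_induction with
  | mem x hx =>
    obtain ⟨r, s', hr, hs', hs'u, hxs⟩ := hx
    obtain ⟨er, herR, her⟩ := hres r hr
    obtain ⟨es, hesR, hes⟩ := hres s' hs'
    -- `es` is a unit of `O` (else `s' = (s' - esᵖ) + esᵖ` would be a non-unit)
    have hesu : es ∉ O.nonunits := by
      intro h
      apply hs'u
      have e1 : s' = (s' - es ^ p) + es ^ (p - 1) * es := by
        rw [← pow_succ, Nat.sub_add_cancel hp.one_lt.le]; ring
      rw [e1]
      exact O.nonunits.add_mem hes (mul_mem_nonunits' O h (O.toSubring.pow_mem (hRO hesR) (p - 1)))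
    have hes0 : es ≠ 0 := ne_zero_of_not_mem_nonunits O hesu
    have hs'0 : s' ≠ 0 := ne_zero_of_not_mem_nonunits O hs'u
    refine ⟨er * es⁻¹, Subring.subset_closure ⟨er, es, herR, hesR, hesu, ?_⟩, ?_⟩
    · rw [mul_assoc, inv_mul_cancel₀ hes0, mul_one]
    · -- `x - (er/es)ᵖ = ((r - erᵖ) esᵖ + erᵖ (esᵖ - s')) / (s' esᵖ)`
      have hx : x = r * s'⁻¹ := by rw [← hxs, mul_assoc, mul_inv_cancel₀ hs'0, mul_one]
      have e2 : x - (er * es⁻¹) ^ p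
          = ((r - er ^ p) * es ^ p + er ^ p * (es ^ p - s')) * (s' * es ^ p)⁻¹ := by
        rw [hx, mul_pow, inv_pow]; field_simp; ring
      rw [e2]
      refine mul_inv_mem_nonunits O ?_ (O.mul_mem _ _ (hRO hs') (O.toSubring.pow_mem (hRO hesR) p)) ?_
      · refine O.nonunits.add_mem (mul_mem_nonunits O her (O.toSubring.pow_mem (hRO hesR) p)) ?_
        rw [mul_comm]
        refine mul_mem_nonunits O ?_ (O.toSubring.pow_mem (hRO herR) p)
        have : es ^ p - s' = -(s' - es ^ p) := by ring
        rw [this]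
        exact O.nonunits.neg_mem hes
      · intro h
        rw [ValuationSubring.mem_nonunits_iff, map_mul, map_pow] at h
        have h1 : O.valuation s' = 1 :=
          le_antisymm ((O.valuation_le_one_iff _).mpr (hRO hs'))
            (not_lt.mp fun h' => hs'u ((O.mem_nonunits_iff).mpr h'))
        have h2 : O.valuation es = 1 :=
          le_antisymm ((O.valuation_le_one_iff _).mpr (hRO hesR))
            (not_lt.mp fun h' => hesu ((O.mem_nonunits_iff).mpr h'))
        rw [h1, h2, one_pow, one_mul] at h
        exact lt_irrefl 1 h
  | zero => exact ⟨0, Subring.zero_mem _, by rw [zero_pow hp.ne_zero, sub_zero]; exact O.nonunits.zero_mem⟩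
  | one => exact ⟨1, Subring.one_mem _, by rw [one_pow, sub_self]; exact O.nonunits.zero_mem⟩
  | add x y _ _ hx hy =>
    obtain ⟨e, he, hxe⟩ := hx
    obtain ⟨f, hf, hyf⟩ := hy
    refine ⟨e + f, Subring.add_mem _ he hf, ?_⟩
    have : x + y - (e + f) ^ p = (x - e ^ p) + (y - f ^ p) := by rw [add_pow_char]; ring
    rw [this]
    exact O.nonunits.add_mem hxe hyf
  | neg x _ hx =>
    obtain ⟨e, he, hxe⟩ := hx
    refine ⟨-e, Subring.neg_mem _ he, ?_⟩
    have : -x - (-e) ^ p = -(x - e ^ p) := by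
      rw [neg_pow, neg_one_pow_char K p]; ring
    rw [this]
    exact O.nonunits.neg_mem hxe
  | mul x y hx' _ hx hy =>
    obtain ⟨e, he, hxe⟩ := hx
    obtain ⟨f, hf, hyf⟩ := hy
    refine ⟨e * f, Subring.mul_mem _ he hf, ?_⟩
    have : x * y - (e * f) ^ p = x * (y - f ^ p) + (x - e ^ p) * f ^ p := by ring
    rw [this]
    refine O.nonunits.add_mem ?_ ?_
    · rw [mul_comm]; exact mul_mem_nonunits O hyf (hle hx')
    · exact mul_mem_nonunits O hxe (O.toSubring.pow_mem (hle hf) p)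
where
  /-- an element of `O` times a non-unit is a non-unit (argument order swapped) -/
  mul_mem_nonunits' (O : ValuationSubring K) {t x : K} (ht : t ∈ O.nonunits) (hx : x ∈ O) :
      x * t ∈ O.nonunits := by
    rw [mul_comm]; exact mul_mem_nonunits O ht hx

/-! ## The residue field of a dominating basin at a closed point is perfect -/

/-- **`p`-th power residues propagate up a dominating basin.** Let `σ⁻¹ S ⊆ S`, let `T` be a valuation
ring with `x ∈ T ↔ σ⁻ⁿ x ∈ S for some n` (the basin) dominating `S` relative to `O`
(`S ∩ 𝔪_O ⊆ 𝔪_T`), and suppose every `s ∈ S` is `eᵖ + (element of S ∩ 𝔪_O)` with `e ∈ S`. Then every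
element of `T` is a `p`-th power modulo `𝔪_T`. [folklore] -/
theorem basin_pow_p_residue {p : ℕ} (σ : K ≃+* K) (S : Subring K) (O T : ValuationSubring K)
    (h1 : ∀ x : K, x ∈ S → σ.symm x ∈ S)
    (hbasin : ∀ x : K, x ∈ T ↔ ∃ n : ℕ, σ.symm^[n] x ∈ S)
    (hdom : ∀ x : K, x ∈ S → x ∈ O.nonunits → x ∈ T.nonunits)
    (hS : ∀ s : K, s ∈ S → ∃ e : K, e ∈ S ∧ s - e ^ p ∈ O.nonunits) :
    ∀ u : K, u ∈ T → ∃ e : K, u - e ^ p ∈ T.nonunits := by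
  -- `σ` preserves `T`, hence `𝔪_T`
  have hσT : ∀ x : K, x ∈ T ↔ σ x ∈ T := by
    intro x
    rw [hbasin, hbasin]
    constructor
    · rintro ⟨n, hn⟩
      exact ⟨n + 1, by rw [Function.iterate_succ_apply, RingEquiv.symm_apply_apply]; exact hn⟩
    · rintro ⟨n, hn⟩
      have h := iterate_symm_mem_of_le σ h1 hn (Nat.le_succ n)
      rw [Function.iterate_succ_apply, RingEquiv.symm_apply_apply] at h
      exact ⟨n, h⟩
  have hσm : ∀ x : K, x ∈ T.nonunits → σ x ∈ T.nonunits := by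
    intro x hx
    by_cases hx0 : x = 0
    · rw [hx0, map_zero]; exact T.nonunits.zero_mem
    rw [ValuationSubring.mem_nonunits_iff_or]
    refine Or.inr fun h => ?_
    rw [← map_inv₀, ← hσT] at h
    rcases (ValuationSubring.mem_nonunits_iff_or (A := T)).mp hx with h' | h'
    · exact hx0 h'
    · exact h' h
  have hσm_iter : ∀ (n : ℕ) (x : K), x ∈ T.nonunits → σ^[n] x ∈ T.nonunits := by
    intro n
    induction n with
    | zero => intro x hx; exact hx
    | succ n ih => intro x hx; rw [Function.iterate_succ_apply']; exact hσm _ (ih x hx)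
  intro u hu
  obtain ⟨n, hn⟩ := (hbasin u).mp hu
  obtain ⟨e, heS, hse⟩ := hS _ hn
  refine ⟨σ^[n] e, ?_⟩
  have hmem : σ.symm^[n] u - e ^ p ∈ T.nonunits := hdom _ (S.sub_mem hn (S.pow_mem heS p)) hse
  have hl : Function.LeftInverse σ σ.symm := σ.apply_symm_apply
  have e1 : u - (σ^[n] e) ^ p = σ^[n] (σ.symm^[n] u - e ^ p) := by
    rw [iterate_map_sub, iterate_map_pow, hl.iterate n u]
  rw [e1]
  exact hσm_iter n _ hmem

/-- **CALIBRATION (negative lemma, line language): no self-similar germ at a CLOSED point with a discrete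
DOMINATING basin.** The germ stub `Sig.stub_selfSimilarGerm` together with "the centre of `O` on `R` is a
maximal ideal" (every `x ∈ R ∖ 𝔪_O` is invertible in `R` modulo `𝔪_O`) and "the basin `T` of
`(σ, locAt R O)` is a DVR dominating `locAt R O`" is FALSE: the residue field of `T` is perfect
(`basin_pow_p_residue` ∘ `locAt_pow_p_residue`), so `T` absorbs `H³_p(K)` and the transported class would
be integral (`mem_Unr_of_discrete_perfect_basin`). [folklore] -/
theorem not_selfSimilarGerm_closedPoint_discrete_dominating_basin :
    ¬ ∃ p : ℕ, p.Prime ∧ ∃ (k K : Type) (_ : Field k) (_ : CharP k p) (_ : PerfectField k) (_ : Field K)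
      (_ : Algebra k K), (⊤ : IntermediateField k K).FG ∧ ∃ O : ValuationSubring K,
      (∀ c : k, algebraMap k K c ∈ O) ∧ ∃ R : Subalgebra k K, R.FG ∧ R.toSubring ≤ O.toSubring ∧
      IsFractionRing R K ∧
      (∀ x : K, x ∈ R → x ∉ O.nonunits → ∃ y : K, y ∈ R ∧ x * y - 1 ∈ O.nonunits) ∧
      ∃ (σ : K ≃+* K) (α : G K ⧸ N p K),
      PeriodicTower p K σ O (locAt (R : Set K) O) α ∧ DivIntegral p k K R O α ∧
      α ∉ Unr p K (locAt (R : Set K) O) ∧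
      ∃ T : ValuationSubring K, (∀ x : K, x ∈ T ↔ ∃ n : ℕ, σ.symm^[n] x ∈ locAt (R : Set K) O) ∧
      IsDiscreteValuationRing T ∧
      ∀ x : K, x ∈ locAt (R : Set K) O → x ∈ O.nonunits → x ∈ T.nonunits := by
  rintro ⟨p, hp, k, K, _, _, _, _, _, -, O, hk, R, hR, hRO, -, hmax, σ, α, hT, -, hloc, T, hbasin,
    hdvr, hdom⟩
  haveI : CharP K p := charP_of_injective_algebraMap (algebraMap k K).injective p
  have hS := locAt_pow_p_residue hp R hR O hk hRO hmax
  have hperf : ∀ u : K, u ∈ T → ∃ e : K, u - e ^ p ∈ T.nonunits :=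
    basin_pow_p_residue σ _ O T hT.1 hbasin hdom hS
  exact hloc (mem_Unr_of_discrete_perfect_basin hp σ O T _ α hT hbasin hdvr hperf)

end Summit.ResolutionOfSingularities.ResolutionOfSingularities.Theorems.WildSymbol.Birth

end
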